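import Literature.NumberTheory.LFunctions.FordProgram1
import HarnessLib

/-!
# Ford's "Program 1": kernel run 42C (`1185 ≤ k ≤ 1190`)

Topic `Literature/NumberTheory/LFunctions`. Everything here is PROVED (kernel evaluations, standard
axioms): `FordP1.checkT k = true` for `1185 ≤ k ≤ 1190`, i.e. the certified re-run of PROGRAM 1 of
K. Ford, Proc. LMS 85 (2002) (the second part of Theorem 3) for these `k` — see `FordProgram1.lean`
for the checker, its soundness `FordP1.row_of_checkK`, and the meaning of the constants
(`ρ = FordP1.rhoOf k / 10⁵`, `θ = FordP1.thetaOf k / 10⁴`, `ω = FordP1.omOf k / 10⁴`). One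
`decide +kernel` per `k` (so that the kernel's evaluation state is bounded by a single run;
`maxHeartbeats 0` lifts the deterministic time-out for each), then the range statement
`FordP1.run42C`. The parts `FordProgram1Run42A/B/C.lean` replace the single kernel run of
the original `FordProgram1Run42.lean` (`1173 ≤ k ≤ 1190` in one `decide`), which exceeded the full
build's resources; `FordProgram1Run42.lean` now merely assembles them into `FordP1.run42`. The
assembly of all runs is `FordTheorem3SmallK.lean`.

## References

* K. Ford, Proc. London Math. Soc. (3) 85 (2002), 565–633; arXiv:1910.08209: Theorem 3, (1.7),
  Lemmas 3.4–3.5, Appendix "PROGRAM 1". [Ford2002]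
-/

namespace Literature.NumberTheory.LFunctions
namespace FordP1

set_option maxHeartbeats 0 in
/-- `checkT 1185`. [cite: Ford2002, Theorem 3 (second part) and PROGRAM 1] -/
theorem checkT_1185 : checkT 1185 = true := by
  decide +kernel

set_option maxHeartbeats 0 in
/-- `checkT 1186`. [cite: Ford2002, Theorem 3 (second part) and PROGRAM 1] -/
theorem checkT_1186 : checkT 1186 = true := by
  decide +kernel

set_option maxHeartbeats 0 in
/-- `checkT 1187`. [cite: Ford2002, Theorem 3 (second part) and PROGRAM 1] -/
theorem checkT_1187 : checkT 1187 = true := by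
  decide +kernel

set_option maxHeartbeats 0 in
/-- `checkT 1188`. [cite: Ford2002, Theorem 3 (second part) and PROGRAM 1] -/
theorem checkT_1188 : checkT 1188 = true := by
  decide +kernel

set_option maxHeartbeats 0 in
/-- `checkT 1189`. [cite: Ford2002, Theorem 3 (second part) and PROGRAM 1] -/
theorem checkT_1189 : checkT 1189 = true := by
  decide +kernel

set_option maxHeartbeats 0 in
/-- `checkT 1190`. [cite: Ford2002, Theorem 3 (second part) and PROGRAM 1] -/
theorem checkT_1190 : checkT 1190 = true := by
  decide +kernel

/-- **Kernel run 42C**: `checkT k` for `1185 ≤ k ≤ 1190`. [cite: Ford2002, Theorem 3 (second part)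
and PROGRAM 1] -/
theorem run42C (k : ℕ) (h1 : 1185 ≤ k) (h2 : k ≤ 1190) : checkT k = true := by
  interval_cases k
  · exact checkT_1185
  · exact checkT_1186
  · exact checkT_1187
  · exact checkT_1188
  · exact checkT_1189
  · exact checkT_1190

end FordP1
end Literature.NumberTheory.LFunctions
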